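import Summits.ValiantsHypothesis.ValiantsHypothesis.Theorems.FifoMatchingNNDivisionHardLocalizationOrbit

/-!
# FifoMatching · NNDivisionHard — localization, part 7: §B the FREE-FACE functor `Face` (GENUS I «one top on a free face»)

Theorems-grade port (bytes staged by val-idea-43 g6 for a port hand) of the crux workfile `Cruxes/NNDivisionHard/Symmetry43.lean`
@1a81e50299bb (sha16 761689e21b9c70ce, 795 l.; val-idea-43 g6, crux `stmt-ValiantsHypothesis-21181` `FifoMatching.NNDivisionHard`; critic of
record val-idea-crit-9 g3 V#97 §4: (A) «NEW (functor): GO», (B) «NEW (functor): GO WITH PRIORITY — the GENUS-I functor», (C) fold into (B)) —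
statements and proofs VERBATIM, namespace `…Theorems.FifoMatching.Localization` (continues parts 1–5 ✓ `…Localization{,Deletion,Switching,Sieve,Orbit}`).

Part 7 (§B).  `Face X ∋ q` :⟺ for SOME functional `w` VALID on `COR(K_h)` (bound `M`), SOME coordinate injection `ι : Fin ℓ ↪ Fin h` with
`⌊√h⌋ ≤ ℓ` that is FREE for the tight set of `w` (every `c : Fin ℓ → Bool` extends to a tight `b` with `b ∘ ι = c`), and SOME re-indexing `e`
of the `w`-TOP generators (covering them up to equal points), the top sub-family read on `ι` lies in `X` at scale `ℓ`.  Then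
`π_ι (F_w COR_h) = COR_ℓ` (`delRead_image_corFace`), `π_ι (F_w conv q) = conv (π_ι ∘ q ∘ e)` (`delRead_image_hullFace`), faces of Minkowski
sums add with NO loss in EF size (Literature `HasEFOfSize.image_face_add_image_face₁`) and the `∀ c` exchange pays the scale
(`T c h ≤ T (2c) ℓ`): ★★ `decided_face : Decided X → Decided (Face X)` (+B; RATE: `X` decided at parameter `2c` from `h₀` gives `Face X`
decided at `c` from `h₀²`; any `ℓ` up to `h` is admissible — the 38/41 instances have `ℓ ≈ h/2`).  `Loc X ≤ Face X` (`loc_le_face`, `w = 0`),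
`X ≤ Face X`; glue ★★★ `corVirtualHard_of_residualLawFace`; `residualLaw_face_of_loc`; enemy side `enemy_not_face` (a residual family is
OUTSIDE `X` on every free face — every deletion AND contraction minor with `≥ √h` vertices, every pin / stable-set face — for every top
sub-family).  GENUS I: ★ `faceQuiet_decided` (`COR_ℓ` + ONE point on a face; Kaibel–Weltge `(3/2)^ℓ`, `ℓ ≥ √h`, beats `T c h` eventually),
`face_of_uniqueTop`, `delLocated_le_faceQuiet` (`DelLocated ≤ Face Quiet` for `h ≥ 2`; the pen's `PinLocated` has the same shape with tight
set `{b ⊇ S}`).  Part 8 (`…LocalizationFaceSpecies`): stable-set and contraction faces, two-scale (lexicographic) tops, the composite with §A.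

Honest label: TEMPLATE + named decided species for the TOP cone; NOT progress on `C′ = ExactPencilLaw` nor on `CoreLawOrb`; 0 explicit residual
members before and after; 21181 OPEN; VP ≠ VNP NOT proved.
-/

set_option linter.unusedVariables false
set_option linter.unusedSectionVars false
set_option linter.dupNamespace false

namespace Summit.ValiantsHypothesis.ValiantsHypothesis.Theorems.FifoMatching.Localization

open Matrix Finset
open scoped Pointwise
open Literature.Barriers.PneNP (HasEFOfSize)
open Literature.Combinatorics.Optimization (corPolytopeGraph corVec)

/-! ## §B FREE-FACE LOCALIZATION -/

/-- **`Face X`**: for SOME valid functional `w` (bound `M` on `COR(K_h)`), SOME coordinate injection `ι : Fin ℓ ↪ Fin h` with `⌊√h⌋ ≤ ℓ`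
that is FREE for the tight set of `w`, and SOME re-indexing `e` of the `w`-top generators (covering them up to equal points), the top
sub-family read on `ι` lies in `X` at scale `ℓ`. -/
def Face (X : PClass) : PClass := fun h K q =>
  ∃ ℓ : ℕ, Nat.sqrt h ≤ ℓ ∧ ∃ (ι : Fin ℓ ↪ Fin h) (w : Fin h × Fin h → ℝ) (M : ℝ),
    (∀ b : Fin h → Bool, w ⬝ᵥ corVec (⊤ : SimpleGraph (Fin h)) b ≤ M) ∧
    (∀ c : Fin ℓ → Bool, ∃ b : Fin h → Bool, w ⬝ᵥ corVec (⊤ : SimpleGraph (Fin h)) b = M ∧ b ∘ ι = c) ∧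
    ∃ (K' : ℕ) (e : Fin (K' + 1) → Fin (K + 1)),
      (∀ j' k, w ⬝ᵥ q k ≤ w ⬝ᵥ q (e j')) ∧
      (∀ j, (∀ k, w ⬝ᵥ q k ≤ w ⬝ᵥ q j) → ∃ j', q (e j') = q j) ∧
      X ℓ K' (⇑(delRead ι) ∘ q ∘ e)

/-- ★ a FREE face of `COR(K_h)` reads ONTO `COR(K_ℓ)`. -/
theorem delRead_image_corFace {h ℓ : ℕ} (ι : Fin ℓ ↪ Fin h) (w : Fin h × Fin h → ℝ) (M : ℝ)
    (hval : ∀ b : Fin h → Bool, w ⬝ᵥ corVec (⊤ : SimpleGraph (Fin h)) b ≤ M)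
    (hfree : ∀ c : Fin ℓ → Bool, ∃ b : Fin h → Bool, w ⬝ᵥ corVec (⊤ : SimpleGraph (Fin h)) b = M ∧ b ∘ ι = c) :
    delRead ι '' (corPolytopeGraph (⊤ : SimpleGraph (Fin h)) ∩ {x | w ⬝ᵥ x = M}) = corPolytopeGraph (⊤ : SimpleGraph (Fin ℓ)) := by
  rw [cor_inter_eq w M hval, LinearMap.image_convexHull, ← Set.range_comp]
  unfold corPolytopeGraph
  congr 1
  ext y
  constructor
  · rintro ⟨⟨b, hb⟩, rfl⟩
    exact ⟨b ∘ ι, by simp only [Function.comp]; rw [delRead_corVec]⟩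
  · rintro ⟨c, rfl⟩
    obtain ⟨b, hb, hbc⟩ := hfree c
    refine ⟨⟨b, hb⟩, ?_⟩
    simp only [Function.comp]
    rw [delRead_corVec, ← hbc]

/-- all `w`-top generators have the same value. -/
theorem top_eq_top {h K K' : ℕ} (q : Fam h K) (w : Fin h × Fin h → ℝ) (e : Fin (K' + 1) → Fin (K + 1))
    (he₁ : ∀ j' k, w ⬝ᵥ q k ≤ w ⬝ᵥ q (e j')) (j' : Fin (K' + 1)) : w ⬝ᵥ q (e j') = w ⬝ᵥ q (e 0) :=
  le_antisymm (he₁ 0 (e j')) (he₁ j' (e 0))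

/-- ★ the TOP face of the passenger hull, read on `ι`, is the hull of the re-indexed top sub-family read on `ι`. -/
theorem delRead_image_hullFace {h ℓ K K' : ℕ} (ι : Fin ℓ ↪ Fin h) (q : Fam h K) (w : Fin h × Fin h → ℝ)
    (e : Fin (K' + 1) → Fin (K + 1)) (he₁ : ∀ j' k, w ⬝ᵥ q k ≤ w ⬝ᵥ q (e j'))
    (he₂ : ∀ j, (∀ k, w ⬝ᵥ q k ≤ w ⬝ᵥ q j) → ∃ j', q (e j') = q j) :
    delRead ι '' (convexHull ℝ (Set.range q) ∩ {y | w ⬝ᵥ y = w ⬝ᵥ q (e 0)}) =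
      convexHull ℝ (Set.range (⇑(delRead ι) ∘ q ∘ e)) := by
  rw [XcDivision.convexHull_range_inter_eq q w _ (he₁ 0), LinearMap.image_convexHull, ← Set.range_comp]
  congr 1
  ext y
  constructor
  · rintro ⟨⟨j, hj⟩, rfl⟩
    have htop : ∀ k, w ⬝ᵥ q k ≤ w ⬝ᵥ q j := fun k => by rw [hj]; exact he₁ 0 k
    obtain ⟨j', hj'⟩ := he₂ j htop
    exact ⟨j', by simp only [Function.comp, hj']⟩
  · rintro ⟨j', rfl⟩
    exact ⟨⟨e j', top_eq_top q w e he₁ j'⟩, rfl⟩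

/-- ★ TRANSPORT through a free face: an EF of the pair at scale `h` is an EF (same size) of `COR(K_ℓ) +` the top sub-family read on `ι`. -/
theorem hasEFOfSize_pair_face {h ℓ K K' : ℕ} (ι : Fin ℓ ↪ Fin h) (w : Fin h × Fin h → ℝ) (M : ℝ)
    (hval : ∀ b : Fin h → Bool, w ⬝ᵥ corVec (⊤ : SimpleGraph (Fin h)) b ≤ M)
    (hfree : ∀ c : Fin ℓ → Bool, ∃ b : Fin h → Bool, w ⬝ᵥ corVec (⊤ : SimpleGraph (Fin h)) b = M ∧ b ∘ ι = c)
    (q : Fam h K) (e : Fin (K' + 1) → Fin (K + 1)) (he₁ : ∀ j' k, w ⬝ᵥ q k ≤ w ⬝ᵥ q (e j'))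
    (he₂ : ∀ j, (∀ k, w ⬝ᵥ q k ≤ w ⬝ᵥ q j) → ∃ j', q (e j') = q j) {r : ℕ}
    (hEF : HasEFOfSize (corPolytopeGraph (⊤ : SimpleGraph (Fin h)) + convexHull ℝ (Set.range q)) r) :
    HasEFOfSize (corPolytopeGraph (⊤ : SimpleGraph (Fin ℓ)) + convexHull ℝ (Set.range (⇑(delRead ι) ∘ q ∘ e))) r := by
  have hP : ∀ x ∈ corPolytopeGraph (⊤ : SimpleGraph (Fin h)), w ⬝ᵥ x ≤ M := by
    unfold corPolytopeGraph
    refine XcDivision.dot_le_of_mem_convexHull _ w M ?_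
    rintro _ ⟨b, rfl⟩
    exact hval b
  have hR : ∀ y ∈ convexHull ℝ (Set.range q), w ⬝ᵥ y ≤ w ⬝ᵥ q (e 0) :=
    XcDivision.dot_le_of_mem_convexHull _ w _ (by rintro _ ⟨k, rfl⟩; exact he₁ 0 k)
  have h1 := hEF.image_face_add_image_face₁ w M (w ⬝ᵥ q (e 0)) hP hR (delRead ι)
  rw [delRead_image_corFace ι w M hval hfree, delRead_image_hullFace ι q w e he₁ he₂] at h1
  exact h1

/-- BUDGETS survive the face-and-read: `conv q` of EF size `r` ⇒ the top sub-family read on `ι` has EF size `r`. -/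
theorem hasEFOfSize_hull_face {h ℓ K K' : ℕ} (ι : Fin ℓ ↪ Fin h) (w : Fin h × Fin h → ℝ)
    (q : Fam h K) (e : Fin (K' + 1) → Fin (K + 1)) (he₁ : ∀ j' k, w ⬝ᵥ q k ≤ w ⬝ᵥ q (e j'))
    (he₂ : ∀ j, (∀ k, w ⬝ᵥ q k ≤ w ⬝ᵥ q j) → ∃ j', q (e j') = q j) {r : ℕ}
    (hB : HasEFOfSize (convexHull ℝ (Set.range q)) r) :
    HasEFOfSize (convexHull ℝ (Set.range (⇑(delRead ι) ∘ q ∘ e))) r := by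
  have h1 := (hB.inter_eq w (w ⬝ᵥ q (e 0))).image_linearMap (delRead ι)
  rw [delRead_image_hullFace ι q w e he₁ he₂] at h1
  exact h1

/-- ★★ **THE FREE-FACE LOCALIZATION THEOREM**: `X` decided ⇒ `Face X` decided (exchange `c ↦ 2c`, as for `Loc`). -/
theorem decided_face {X : PClass} (hX : Decided X) : Decided (Face X) := by
  intro c
  obtain ⟨h₀, H⟩ := hX (2 * c)
  refine ⟨h₀ * h₀, fun h hh K q r hq hEF => ?_⟩
  obtain ⟨ℓ, hℓ, ι, w, M, hval, hfree, K', e, he₁, he₂, hx⟩ := hq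
  have hℓ₀ : h₀ ≤ ℓ := by
    have e1 : Nat.sqrt (h₀ * h₀) = h₀ := Nat.sqrt_eq h₀
    calc h₀ = Nat.sqrt (h₀ * h₀) := e1.symm
      _ ≤ Nat.sqrt h := Nat.sqrt_le_sqrt hh
      _ ≤ ℓ := hℓ
  exact lt_of_le_of_lt (T_le_T_double c hℓ)
    (H ℓ hℓ₀ K' _ r hx (hasEFOfSize_pair_face ι w M hval hfree q e he₁ he₂ hEF))

/-- budgeted version. -/
theorem decidedB_face {X : PClass} (hX : DecidedB X) : DecidedB (Face X) := by
  intro c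
  obtain ⟨h₀, H⟩ := hX (2 * c)
  refine ⟨h₀ * h₀, fun h hh K q r hq hB hEF => ?_⟩
  obtain ⟨ℓ, hℓ, ι, w, M, hval, hfree, K', e, he₁, he₂, hx⟩ := hq
  have hℓ₀ : h₀ ≤ ℓ := by
    have e1 : Nat.sqrt (h₀ * h₀) = h₀ := Nat.sqrt_eq h₀
    calc h₀ = Nat.sqrt (h₀ * h₀) := e1.symm
      _ ≤ Nat.sqrt h := Nat.sqrt_le_sqrt hh
      _ ≤ ℓ := hℓ
  exact lt_of_le_of_lt (T_le_T_double c hℓ)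
    (H ℓ hℓ₀ K' _ r hx (hasEFOfSize_hull_face ι w q e he₁ he₂ hB) (hasEFOfSize_pair_face ι w M hval hfree q e he₁ he₂ hEF))

/-- `Face` is monotone in the class. -/
theorem face_mono {X Y : PClass} (hXY : ∀ h K (q : Fam h K), X h K q → Y h K q) {h K : ℕ} {q : Fam h K}
    (hq : Face X h K q) : Face Y h K q := by
  obtain ⟨ℓ, hℓ, ι, w, M, hval, hfree, K', e, he₁, he₂, hx⟩ := hq
  exact ⟨ℓ, hℓ, ι, w, M, hval, hfree, K', e, he₁, he₂, hXY _ _ _ hx⟩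

/-- ★ `Loc X ≤ Face X` (the trivial face `w = 0`: every coordinate set is free, every generator is top). -/
theorem loc_le_face {X : PClass} {h K : ℕ} {q : Fam h K} (hq : Loc X h K q) : Face X h K q := by
  obtain ⟨ℓ, hℓ, ι, hx⟩ := hq
  refine ⟨ℓ, hℓ, ι, 0, 0, fun b => by rw [zero_dotProduct], fun c => ?_, K, id, fun j' k => by rw [zero_dotProduct, zero_dotProduct],
    fun j _ => ⟨j, rfl⟩, ?_⟩
  · refine ⟨Function.extend ι c (fun _ => false), by rw [zero_dotProduct], ?_⟩
    funext a
    exact ι.injective.extend_apply _ _ a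
  · exact hx

/-- hence `Face X` contains `X` itself. -/
theorem le_face {X : PClass} {h K : ℕ} {q : Fam h K} (hq : X h K q) : Face X h K q :=
  loc_le_face (le_loc X hq)

/-- ★★★ **GLUE (free-face form)**: with `X` decided it suffices to prove the residual law on budgeted families OUTSIDE `Face X` — outside `X`
on every free face (every deletion minor, every pin / contraction / stable-set face) for every top sub-family. -/
theorem corVirtualHard_of_residualLawFace {X : PClass} (hX : Decided X) (hR : ResidualLaw (Face X)) : CorVirtualHard :=
  corVirtualHard_of_residualLaw (decided_face hX) hR

/-- the residual law only gets weaker: `ResidualLaw (Loc X) → ResidualLaw (Face X)`. -/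
theorem residualLaw_face_of_loc {X : PClass} (hR : ResidualLaw (Loc X)) : ResidualLaw (Face X) :=
  residualLaw_anti (fun _ _ _ => loc_le_face) hR

/-- **N25 (enemy side)**: below the threshold the family is OUTSIDE `X` on every free face, for every top sub-family re-indexing. -/
theorem enemy_not_face {X : PClass} (hX : Decided X) (c : ℕ) :
    ∃ h₀ : ℕ, ∀ h ≥ h₀, ∀ (K : ℕ) (q : Fam h K) (r : ℕ),
      HasEFOfSize (corPolytopeGraph (⊤ : SimpleGraph (Fin h)) + convexHull ℝ (Set.range q)) r → r ≤ T c h → ¬ Face X h K q := by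
  obtain ⟨h₀, hh₀⟩ := decided_face hX c
  exact ⟨h₀, fun h hh K q r hEF hr hq => absurd (hh₀ h hh K q r hq hEF) (not_lt.2 hr)⟩

/-! ### §B2 GENUS I: the unique-top families (`Face Quiet`) -/

/-- ★ `Face Quiet` is decided (GENUS I «one top on a free face»): a free face whose passenger top is a SINGLE POINT locates the pair — contains
`DelLocated` for `h ≥ 2` (`delLocated_le_faceQuiet`), every «tight on a free face + unique maximiser» family (`face_of_uniqueTop`; the pen's
`PinLocated` has this shape with tight set `{b ⊇ S}`), and the lexicographic unique tops (`faceQuiet_of_twoScaleTop`, §B3). -/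
theorem faceQuiet_decided : Decided (Face Quiet) := decided_face quiet_decided

/-- a free face with a UNIQUE top generator point puts the family in `Face Quiet`. -/
theorem face_of_uniqueTop {h ℓ K : ℕ} (q : Fam h K) (hℓ : Nat.sqrt h ≤ ℓ) (ι : Fin ℓ ↪ Fin h) (w : Fin h × Fin h → ℝ) (M : ℝ)
    (hval : ∀ b : Fin h → Bool, w ⬝ᵥ corVec (⊤ : SimpleGraph (Fin h)) b ≤ M)
    (hfree : ∀ c : Fin ℓ → Bool, ∃ b : Fin h → Bool, w ⬝ᵥ corVec (⊤ : SimpleGraph (Fin h)) b = M ∧ b ∘ ι = c)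
    (j₀ : Fin (K + 1)) (htop : ∀ j, w ⬝ᵥ q j < w ⬝ᵥ q j₀ ∨ q j = q j₀) : Face Quiet h K q := by
  refine ⟨ℓ, hℓ, ι, w, M, hval, hfree, 0, fun _ => j₀, fun _ k => ?_, fun j hj => ⟨0, ?_⟩, fun j => rfl⟩
  · rcases htop k with h1 | h1
    · exact h1.le
    · rw [h1]
  · rcases htop j with h1 | h1
    · exact absurd (hj j₀) (not_le.2 h1)
    · exact h1.symm

/-- ★ `DelLocated ≤ Face Quiet` at every scale `h = n + 1` with `⌊√(n+1)⌋ ≤ n` (i.e. `h ≥ 2`): the deletion-located families of §9 are the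
free-face instances «tight set ⊇ {b_{x₀} = 0}, free transversal = skip `x₀`, unique top». -/
theorem delLocated_le_faceQuiet {n K : ℕ} {q : Fam (n + 1) K} (hn : Nat.sqrt (n + 1) ≤ n) (hq : DelLocated (n + 1) K q) :
    Face Quiet (n + 1) K q := by
  obtain ⟨x₀, C, M, hval, htight, j₀, htop⟩ := hq
  refine face_of_uniqueTop q hn (Fin.succAboveEmb x₀) C M hval (fun c => ?_) j₀ htop
  refine ⟨Fin.insertNth x₀ false c, htight _ (by simp), ?_⟩
  funext a
  simp


end Summit.ValiantsHypothesis.ValiantsHypothesis.Theorems.FifoMatching.Localization
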